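import Literature.NumberTheory.GelbartRogawski1991.Prop311ModelIndependence
import HarnessLib

/-!
# [GelbartRogawski1991, Prop. 3.1.1] AS PRINTED: rescaling the skew-Hermitian form, `(V, Φ, ψ(ξ ·)) ↔ (V, ξΦ, ψ)`

Topic `NumberTheory/GelbartRogawski1991`; namespace `Literature.NumberTheory.GelbartRogawski1991.Prop311`.  KERNEL ONLY:
theorems; no definition, no named fact, no `sorry`; `Prop311AsPrinted` is untouched.

`Prop311AsPrinted` quantifies over an ARBITRARY non-trivial character `ψ` of `F\𝐀` ([GelbartRogawski1991, §1.1 p. 449 L32]),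
while the smooth model of record `Weil1964.adelicSchrodinger` and the unitary leg `Weil1964.adelicMpCont.unitaryLegL2` are
built over Tate's standard character `ψ_F = adeleAddChar F`; every `ψ` is `ψ_F(ξ ·)` for a unique `ξ ∈ Fˣ`
(`IsGlobalAddChar.exists_eq_mulShift_adeleAddChar`, [CasselsFrohlichANT1967, Ch. XV Thm 4.1.4]).  This file removes the
discrepancy INSIDE the printed statement: for `ξ ∈ Fˣ` the printed data `(V, Φ)` and `(V, ξΦ)` have

* the same symplectic group `Sp_𝐀(W)`, unitary group `G(𝐀)`, rational symplectic group `Sp_F(W)` and rational points `G(F)`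
  (§2: `adelicSp_smul`, `adelicUnitary_smul`, `ratSp_smul`, `isRationalPoint_smul_iff`; the forms differ by the unit `ξ`:
  §1), and `(V, ξΦ)` is again skew-Hermitian with `Tr(ξΦ)` non-degenerate (§3);
* Heisenberg groups exchanged by `τ_ξ : H_𝐀(W, ½ξφ) → H_𝐀(W, ½φ)`, `(w, t) ↦ (w, ξ⁻¹ t)` (Weil's functoriality
  `Heisenberg.map`; §4: bijective, bicontinuous for `heisenbergTopology`, identity on `W_𝐀`, compatible with Weil's actions
  `ofSymplectic` of `Sp_𝐀(W)` — `heisTwist_act`);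
* so that a printed model `ρ` of `ρ_ψ` for `(V, Φ)` with central character `ψ` gives the printed model `ρ ∘ τ` for `(V, ξΦ)`
  with central character `t ↦ ψ(ξ⁻¹ t)` (§5, for any such isomorphism `τ` over `W_𝐀`: unitary, strongly continuous,
  irreducible, central character).

The companion file `Prop311PrintedFormRescalingMp` identifies print's groups of bounded pairs `Mp_𝐀(W)` over the two models
and transports rational splittings and clauses (1) ∧ (2) of Prop. 3.1.1 from `(V, ξΦ, ρ ∘ τ_ξ)` to `(V, Φ, ρ)`.  With `ξ` chosen
so that `ψ(ξ⁻¹ ·) = ψ_F`, the printed proposition for an arbitrary `ψ` is thereby reduced to the case `ψ = ψ_F` (for the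
rescaled, again skew-Hermitian, space `(V, ξΦ)`), where `Prop311ModelIndependence.conclusion_of_conclusion` and the `L²` leg
apply.  No mathematics beyond bookkeeping: [GelbartRogawski1991, §3.1 p. 454 L17–42] introduces every object as
a function of `(W, φ) = (V, Tr Φ)` and `ψ`, and `(ξφ, ψ)` / `(φ, ψ(ξ·))` define the same Heisenberg group up to `τ_ξ`
([Weil1964, Chap. I n° 3–5]; [MoeglinVignerasWaldspurger1987, Chap. 2 I.1–I.2]).

## References
* [GelbartRogawski1991] S. Gelbart, J. Rogawski, Invent. Math. 105 (1991) 445–472, §1.1 p. 449 L32, §3.1 p. 454 L17–42,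
  Prop. 3.1.1 p. 455 L1–2.
* [Weil1964] A. Weil, Acta Math. 111 (1964) 143–211, Chap. I n° 3–5 pp. 149–151.
* [MoeglinVignerasWaldspurger1987] C. Mœglin, M.-F. Vignéras, J.-L. Waldspurger, LNM 1291 (1987), Chap. 2 I.1–I.2, II.1.
* [CasselsFrohlichANT1967] J. W. S. Cassels, A. Fröhlich (eds.), Algebraic Number Theory (1967), Ch. XV (Tate) Thm 4.1.4.
-/

set_option autoImplicit false

noncomputable section

open NumberField
open scoped TensorProduct
open Literature.RepresentationTheory.HeisenbergGroup

namespace Literature.NumberTheory.GelbartRogawski1991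

namespace Prop311

variable (F : Type) [Field F] [NumberField F]
variable (E : Type) [Field E] [Algebra F E]
variable (V : Type) [AddCommGroup V] [Module F V]
variable (Φ : V →ₗ[F] V →ₗ[F] E) (ξ : F)

/-! ## §1 The forms of `(V, ξΦ)` -/

omit [NumberField F] in
/-- `(ξΦ)(x, y) = ξ Φ(x, y)`. [cite: GelbartRogawski1991, §3.1 p. 454 L37–38] -/
theorem smul_form_apply (x y : V) : (ξ • Φ) x y = ξ • Φ x y := rfl

omit [NumberField F] in
/-- `Tr(ξΦ) = ξ Tr Φ` pointwise. [cite: GelbartRogawski1991, §3.1 p. 454 L41–42] -/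
theorem traceForm_smul_apply (x y : V) : traceForm F E V (ξ • Φ) x y = ξ * traceForm F E V Φ x y := by
  rw [traceForm_apply, traceForm_apply, smul_form_apply, map_smul, smul_eq_mul]

/-- `(ξφ)_𝐀 = ξ φ_𝐀` pointwise on `W_𝐀 = 𝐀 ⊗_F V`. [cite: GelbartRogawski1991, §3.1 p. 454 L17, L22] -/
theorem adelicTraceForm_smul_apply (w w' : AdelicSpace F V) :
    adelicTraceForm F E V (ξ • Φ) w w' = algebraMap F (AdeleRing (𝓞 F) F) ξ * adelicTraceForm F E V Φ w w' := by
  induction w using TensorProduct.induction_on with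
  | zero => simp only [map_zero, LinearMap.zero_apply, mul_zero]
  | add w₁ w₂ h₁ h₂ => simp only [map_add, LinearMap.add_apply, h₁, h₂, mul_add]
  | tmul a v =>
    induction w' using TensorProduct.induction_on with
    | zero => simp only [map_zero, mul_zero]
    | add w₁ w₂ h₁ h₂ => simp only [map_add, h₁, h₂, mul_add]
    | tmul a' v' =>
      simp only [adelicTraceForm, LinearMap.BilinForm.baseChange_tmul, traceForm_smul_apply, Algebra.smul_def, map_mul,
        mul_assoc]

/-- the Heisenberg laws: `½(ξφ)_𝐀 = ξ · ½φ_𝐀` pointwise. [cite: GelbartRogawski1991, §3.1 p. 454 L17–19] -/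
theorem heisForm_smul_apply (w w' : AdelicSpace F V) :
    heisForm F E V (ξ • Φ) w w' = algebraMap F (AdeleRing (𝓞 F) F) ξ * heisForm F E V Φ w w' := by
  simp only [heisForm, LinearMap.smul_apply, adelicTraceForm_smul_apply, smul_eq_mul]
  ring

/-- `(ξΦ)_𝐀 = ξ Φ_𝐀` pointwise, values in `𝐀 ⊗_F E`. [cite: GelbartRogawski1991, §3.1 p. 454 L37–38] -/
theorem adelicHermForm_smul_apply (w w' : AdelicSpace F V) :
    adelicHermForm F E V (ξ • Φ) w w' = ξ • adelicHermForm F E V Φ w w' := by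
  induction w using TensorProduct.induction_on with
  | zero => simp only [map_zero, LinearMap.zero_apply, smul_zero]
  | add w₁ w₂ h₁ h₂ => simp only [map_add, LinearMap.add_apply, h₁, h₂, smul_add]
  | tmul a v =>
    induction w' using TensorProduct.induction_on with
    | zero => simp only [map_zero, smul_zero]
    | add w₁ w₂ h₁ h₂ => simp only [map_add, h₁, h₂, smul_add]
    | tmul a' v' =>
      simp only [adelicHermForm, LinearMap.BilinMap.baseChange_tmul, smul_form_apply, TensorProduct.tmul_smul]

/-! ## §2 The groups of `(V, ξΦ)` are the groups of `(V, Φ)` -/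

variable {ξ} (hξ : ξ ≠ 0)

include hξ in
/-- **`Sp_𝐀(W)` is unchanged**: `Sp(½(ξφ)_𝐀) = Sp(½φ_𝐀)`. [cite: GelbartRogawski1991, §3.1 p. 454 L18, L22] -/
theorem adelicSp_smul : adelicSp F E V (ξ • Φ) = adelicSp F E V Φ := by
  have hu : IsUnit (algebraMap F (AdeleRing (𝓞 F) F) ξ) := (IsUnit.mk0 ξ hξ).map _
  refine Subgroup.ext fun g => ?_
  simp only [mem_symplecticGroup, heisForm_smul_apply, ← mul_sub]
  exact forall₂_congr fun w w' => hu.mul_right_inj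

include hξ in
/-- **`G(𝐀)` is unchanged**: `U(V, ξΦ)(𝐀) = U(V, Φ)(𝐀)`. [cite: GelbartRogawski1991, §3.1 p. 454 L37–38] -/
theorem adelicUnitary_smul [Module E V] [IsScalarTower F E V] : adelicUnitary F E V (ξ • Φ) = adelicUnitary F E V Φ := by
  refine Subgroup.ext fun g => ?_
  rw [mem_adelicUnitary, mem_adelicUnitary]
  refine and_congr Iff.rfl ⟨fun h x y => ?_, fun h x y => ?_⟩
  · have h1 := congrArg (fun z => ξ⁻¹ • z) (h x y)
    simpa only [adelicHermForm_smul_apply, inv_smul_smul₀ hξ] using h1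
  · rw [adelicHermForm_smul_apply, adelicHermForm_smul_apply, h x y]

include hξ in
omit [NumberField F] in
/-- **`Sp_F(W)` is unchanged**. [cite: GelbartRogawski1991, §3.1 p. 454 L35–36] -/
theorem ratSp_smul : ratSp F E V (ξ • Φ) = ratSp F E V Φ := by
  refine Subgroup.ext fun g => ?_
  simp only [mem_ratSp, traceForm_smul_apply, mul_right_inj' hξ]

include hξ in
/-- **`G(F)` is unchanged**: an `E`-linear automorphism of `V` preserves `ξΦ` iff it preserves `Φ`.
[cite: GelbartRogawski1991, Prop. 3.1.1 p. 455 L2] -/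
theorem isRationalPoint_smul_iff [Module E V] [IsScalarTower F E V]
    (g : AdelicSpace F V ≃ₗ[AdeleRing (𝓞 F) F] AdelicSpace F V) :
    IsRationalPoint F E V (ξ • Φ) g ↔ IsRationalPoint F E V Φ g := by
  refine exists_congr fun g₀ => and_congr ⟨fun h x y => ?_, fun h x y => ?_⟩ Iff.rfl
  · have h1 := congrArg (fun z => ξ⁻¹ • z) (h x y)
    simpa only [smul_form_apply, inv_smul_smul₀ hξ] using h1
  · rw [smul_form_apply, smul_form_apply, h x y]

/-! ## §3 `(V, ξΦ)` is skew-Hermitian with `Tr(ξΦ)` non-degenerate -/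

omit [NumberField F] in
/-- `E`-linearity in the first variable passes to `ξΦ`. [cite: GelbartRogawski1991, §3.1 p. 454 L37] -/
theorem smul_form_linear_left [Module E V] (hΦ₁ : ∀ (a : E) (x y : V), Φ (a • x) y = a * Φ x y) (a : E) (x y : V) :
    (ξ • Φ) (a • x) y = a * (ξ • Φ) x y := by
  rw [smul_form_apply, smul_form_apply, hΦ₁, mul_smul_comm]

omit [NumberField F] in
/-- `σ`-semilinearity in the second variable passes to `ξΦ`. [cite: GelbartRogawski1991, §3.1 p. 454 L37] -/
theorem smul_form_semilinear_right [Module E V] (σ : E ≃ₐ[F] E) (hΦ₂ : ∀ (a : E) (x y : V), Φ x (a • y) = Φ x y * σ a)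
    (a : E) (x y : V) : (ξ • Φ) x (a • y) = (ξ • Φ) x y * σ a := by
  rw [smul_form_apply, smul_form_apply, hΦ₂, smul_mul_assoc]

omit [NumberField F] in
/-- skewness passes to `ξΦ` (`ξ ∈ F` is fixed by `σ`). [cite: GelbartRogawski1991, §3.1 p. 454 L37] -/
theorem smul_form_skew (σ : E ≃ₐ[F] E) (hΦ₃ : ∀ x y : V, Φ y x = -σ (Φ x y)) (x y : V) :
    (ξ • Φ) y x = -σ ((ξ • Φ) x y) := by
  rw [smul_form_apply, smul_form_apply, hΦ₃, map_smul, smul_neg]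

include hξ in
omit [NumberField F] in
/-- non-degeneracy of `Tr Φ` passes to `Tr(ξΦ) = ξ Tr Φ`. [cite: GelbartRogawski1991, §3.1 p. 454 L17, L40–42] -/
theorem nondegenerate_traceForm_smul (hφ : (traceForm F E V Φ).Nondegenerate) :
    (traceForm F E V (ξ • Φ)).Nondegenerate := by
  refine ⟨fun x hx => hφ.1 x fun y => ?_, fun y hy => hφ.2 y fun x => ?_⟩
  · have h1 := hx y
    rw [traceForm_smul_apply] at h1
    exact (mul_eq_zero.1 h1).resolve_left hξ
  · have h1 := hy x
    rw [traceForm_smul_apply] at h1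
    exact (mul_eq_zero.1 h1).resolve_left hξ

/-! ## §4 The isomorphism of Heisenberg groups `τ_ξ : H_𝐀(W, ½ξφ) → H_𝐀(W, ½φ)`, `(w, t) ↦ (w, ξ⁻¹ t)` -/

include hξ in
/-- the compatibility of `(id, ξ⁻¹ ·)` with the two Heisenberg laws (hypothesis of `Heisenberg.map`).
[cite: Weil1964, Chap. I n° 3–4] -/
theorem heisTwist_compat (v w : AdelicSpace F V) :
    heisForm F E V Φ ((AddMonoidHom.id (AdelicSpace F V)) v) ((AddMonoidHom.id (AdelicSpace F V)) w) =
      (AddMonoidHom.mulLeft (algebraMap F (AdeleRing (𝓞 F) F) ξ⁻¹)) (heisForm F E V (ξ • Φ) v w) := by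
  rw [AddMonoidHom.id_apply, AddMonoidHom.id_apply, AddMonoidHom.coe_mulLeft, heisForm_smul_apply, ← mul_assoc,
    ← map_mul, inv_mul_cancel₀ hξ, map_one, one_mul]

/-- `τ_ξ` on the vector component: the identity. [cite: Weil1964, Chap. I n° 3–4] -/
theorem heisTwist_v (h : AdelicHeisenberg F E V (ξ • Φ)) :
    (Heisenberg.map (heisForm F E V Φ) (AddMonoidHom.id _) (AddMonoidHom.mulLeft (algebraMap F (AdeleRing (𝓞 F) F) ξ⁻¹))
      (heisTwist_compat F E V Φ hξ) h).v = h.v := by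
  rw [Heisenberg.map_apply_v, AddMonoidHom.id_apply]

/-- `τ_ξ` on the central component: `t ↦ ξ⁻¹ t`. [cite: Weil1964, Chap. I n° 3–4] -/
theorem heisTwist_t (h : AdelicHeisenberg F E V (ξ • Φ)) :
    (Heisenberg.map (heisForm F E V Φ) (AddMonoidHom.id _) (AddMonoidHom.mulLeft (algebraMap F (AdeleRing (𝓞 F) F) ξ⁻¹))
      (heisTwist_compat F E V Φ hξ) h).t = algebraMap F (AdeleRing (𝓞 F) F) ξ⁻¹ * h.t := by
  rw [Heisenberg.map_apply_t, AddMonoidHom.coe_mulLeft]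

/-- `τ_ξ` is onto: `(w, t) = τ_ξ (w, ξ t)`. [cite: Weil1964, Chap. I n° 3–4] -/
theorem heisTwist_surjective :
    Function.Surjective (Heisenberg.map (heisForm F E V Φ) (AddMonoidHom.id _)
      (AddMonoidHom.mulLeft (algebraMap F (AdeleRing (𝓞 F) F) ξ⁻¹)) (heisTwist_compat F E V Φ hξ)) := fun h => by
  refine ⟨⟨h.v, algebraMap F (AdeleRing (𝓞 F) F) ξ * h.t⟩, ?_⟩
  apply Heisenberg.ext
  · rw [heisTwist_v F E V Φ hξ]
  · rw [heisTwist_t F E V Φ hξ, ← mul_assoc, ← map_mul, inv_mul_cancel₀ hξ, map_one, one_mul]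

/-- `τ_ξ` on the centre: `(0, t) ↦ (0, ξ⁻¹ t)`. [cite: Weil1964, Chap. I n° 3–4] -/
theorem heisTwist_ofCenter (t : AdeleRing (𝓞 F) F) :
    Heisenberg.map (heisForm F E V Φ) (AddMonoidHom.id _) (AddMonoidHom.mulLeft (algebraMap F (AdeleRing (𝓞 F) F) ξ⁻¹))
        (heisTwist_compat F E V Φ hξ) (Heisenberg.ofCenter (heisForm F E V (ξ • Φ)) (Multiplicative.ofAdd t)) =
      Heisenberg.ofCenter (heisForm F E V Φ) (Multiplicative.ofAdd (algebraMap F (AdeleRing (𝓞 F) F) ξ⁻¹ * t)) := by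
  rw [Heisenberg.map_ofCenter, AddMonoidHom.coe_mulLeft]

/-- `τ_ξ` is continuous for the printed topologies `heisenbergTopology` (`W_𝐀 × 𝐀` on both sides).
[cite: GelbartRogawski1991, §3.1 p. 454 L20] -/
theorem continuous_heisTwist :
    @Continuous _ _ (heisenbergTopology F E V (ξ • Φ)) (heisenbergTopology F E V Φ)
      (Heisenberg.map (heisForm F E V Φ) (AddMonoidHom.id _) (AddMonoidHom.mulLeft (algebraMap F (AdeleRing (𝓞 F) F) ξ⁻¹))
        (heisTwist_compat F E V Φ hξ)) := by
  letI : TopologicalSpace (AdelicSpace F V) := adelicSpaceTopology F V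
  letI : TopologicalSpace (AdelicHeisenberg F E V (ξ • Φ)) := heisenbergTopology F E V (ξ • Φ)
  have hv : Continuous fun h : AdelicHeisenberg F E V (ξ • Φ) => h.v :=
    continuous_heisenberg_v (heisForm F E V (ξ • Φ)) (adelicSpaceTopology F V) inferInstance
  have ht : Continuous fun h : AdelicHeisenberg F E V (ξ • Φ) => algebraMap F (AdeleRing (𝓞 F) F) ξ⁻¹ * h.t :=
    continuous_const.mul (continuous_heisenberg_t (heisForm F E V (ξ • Φ)) (adelicSpaceTopology F V) inferInstance)
  exact continuous_heisenberg_mk (heisForm F E V Φ) (adelicSpaceTopology F V) inferInstance hv ht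

/-- **`τ_ξ` intertwines Weil's actions of `Sp_𝐀(W)`** on the two Heisenberg groups: for `g ∈ Sp(½φ_𝐀) = Sp(½ξφ_𝐀)`,
`τ_ξ (g · h) = g · τ_ξ h` (the second-degree corrections `½(B(gw,gw) - B(w,w))` scale by `ξ`).
[cite: Weil1964, Chap. I n° 5 pp. 150–151; MoeglinVignerasWaldspurger1987, Chap. 2 I.2] -/
theorem heisTwist_act (g : AdelicSpace F V ≃ₗ[AdeleRing (𝓞 F) F] AdelicSpace F V) (hg : g ∈ adelicSp F E V Φ)
    (hg' : g ∈ adelicSp F E V (ξ • Φ)) (h : AdelicHeisenberg F E V (ξ • Φ)) :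
    Heisenberg.map (heisForm F E V Φ) (AddMonoidHom.id _) (AddMonoidHom.mulLeft (algebraMap F (AdeleRing (𝓞 F) F) ξ⁻¹))
        (heisTwist_compat F E V Φ hξ) ((ofSymplectic (heisForm F E V (ξ • Φ)) ⟨g, hg'⟩).act h) =
      (ofSymplectic (heisForm F E V Φ) ⟨g, hg⟩).act
        (Heisenberg.map (heisForm F E V Φ) (AddMonoidHom.id _)
          (AddMonoidHom.mulLeft (algebraMap F (AdeleRing (𝓞 F) F) ξ⁻¹)) (heisTwist_compat F E V Φ hξ) h) := by
  have h1 : algebraMap F (AdeleRing (𝓞 F) F) ξ⁻¹ * algebraMap F (AdeleRing (𝓞 F) F) ξ = 1 := by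
    rw [← map_mul, inv_mul_cancel₀ hξ, map_one]
  have key : ∀ T X : AdeleRing (𝓞 F) F,
      algebraMap F (AdeleRing (𝓞 F) F) ξ⁻¹ * (T + ⅟(2 : AdeleRing (𝓞 F) F) * (algebraMap F (AdeleRing (𝓞 F) F) ξ * X)) =
        algebraMap F (AdeleRing (𝓞 F) F) ξ⁻¹ * T + ⅟(2 : AdeleRing (𝓞 F) F) * X := fun T X => by
    linear_combination (⅟(2 : AdeleRing (𝓞 F) F) * X) * h1
  apply Heisenberg.ext
  · rw [heisTwist_v F E V Φ hξ, Heisenberg.PseudoSymplectic.act_v, Heisenberg.PseudoSymplectic.act_v, heisTwist_v F E V Φ hξ,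
      ofSymplectic_σ, ofSymplectic_σ]
  · rw [heisTwist_t F E V Φ hξ, Heisenberg.PseudoSymplectic.act_t, Heisenberg.PseudoSymplectic.act_t, heisTwist_t F E V Φ hξ,
      heisTwist_v F E V Φ hξ, ofSymplectic_f, ofSymplectic_f, heisForm_smul_apply, heisForm_smul_apply, ← mul_sub, key]

/-! ## §5 Printed models transported along an isomorphism `τ : H_𝐀(W, ½ξφ) → H_𝐀(W, ½φ)` over `W_𝐀` -/

section Model

variable {F E V Φ}
variable (τ : AdelicHeisenberg F E V (ξ • Φ) →* AdelicHeisenberg F E V Φ)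
variable {S : Type} [NormedAddCommGroup S] [InnerProductSpace ℂ S]
variable (ρ : Representation ℂ (AdelicHeisenberg F E V Φ) S)

omit hξ in
/-- the transported model `ρ ∘ τ` on an element. [cite: GelbartRogawski1991, §3.1 p. 454 L20–21] -/
theorem comp_apply_apply (h : AdelicHeisenberg F E V (ξ • Φ)) (f : S) : (ρ.comp τ) h f = ρ (τ h) f := by
  rw [MonoidHom.coe_comp, Function.comp_apply]

omit hξ in
/-- `ρ ∘ τ` is unitary if `ρ` is (binder `_hρu`). [cite: GelbartRogawski1991, §3.1 p. 454 L20–21] -/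
theorem norm_comp_apply (hρu : ∀ (h : AdelicHeisenberg F E V Φ) (f : S), ‖ρ h f‖ = ‖f‖)
    (h : AdelicHeisenberg F E V (ξ • Φ)) (f : S) : ‖(ρ.comp τ) h f‖ = ‖f‖ := by
  rw [comp_apply_apply, hρu]

omit hξ in
/-- `ρ ∘ τ` has continuous orbit maps if `ρ` has and `τ` is continuous (binder `_hρc`).
[cite: GelbartRogawski1991, §3.1 p. 454 L20–21] -/
theorem continuous_comp_apply (hτ : @Continuous _ _ (heisenbergTopology F E V (ξ • Φ)) (heisenbergTopology F E V Φ) τ)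
    (hρc : ∀ f : S, @Continuous _ _ (heisenbergTopology F E V Φ) _ fun h => ρ h f) (f : S) :
    @Continuous _ _ (heisenbergTopology F E V (ξ • Φ)) _ fun h => (ρ.comp τ) h f := by
  letI : TopologicalSpace (AdelicHeisenberg F E V (ξ • Φ)) := heisenbergTopology F E V (ξ • Φ)
  letI : TopologicalSpace (AdelicHeisenberg F E V Φ) := heisenbergTopology F E V Φ
  have e1 : (fun h => (ρ.comp τ) h f) = (fun h => ρ h f) ∘ τ := by
    funext h
    rw [Function.comp_apply, comp_apply_apply]
  rw [e1]
  exact (hρc f).comp hτ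

omit hξ in
/-- `ρ ∘ τ` is irreducible if `ρ` is and `τ` is onto (binder `_hρi`). [cite: GelbartRogawski1991, §3.1 p. 454 L20–21] -/
theorem irreducible_comp (hτ : Function.Surjective τ)
    (hρi : ∀ K : Submodule ℂ S, IsClosed (K : Set S) →
      (∀ (h : AdelicHeisenberg F E V Φ), ∀ f ∈ K, ρ h f ∈ K) → K = ⊥ ∨ K = ⊤)
    (K : Submodule ℂ S) (hKc : IsClosed (K : Set S))
    (hK : ∀ (h : AdelicHeisenberg F E V (ξ • Φ)), ∀ f ∈ K, (ρ.comp τ) h f ∈ K) : K = ⊥ ∨ K = ⊤ := by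
  refine hρi K hKc fun h f hf => ?_
  obtain ⟨h', rfl⟩ := hτ h
  have h1 := hK h' f hf
  rw [comp_apply_apply] at h1
  exact h1

omit hξ in
/-- central character of `ρ ∘ τ`: if `τ(0, t) = (0, c t)` and `ρ` has central character `ψ`, then `ρ ∘ τ` has central
character `t ↦ ψ(c t)` (binder `_hρz`). [cite: GelbartRogawski1991, §3.1 p. 454 L20–21] -/
theorem comp_ofCenter (c : AdeleRing (𝓞 F) F)
    (hτz : ∀ t : AdeleRing (𝓞 F) F, τ (Heisenberg.ofCenter (heisForm F E V (ξ • Φ)) (Multiplicative.ofAdd t)) =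
      Heisenberg.ofCenter (heisForm F E V Φ) (Multiplicative.ofAdd (c * t)))
    (ψ : AddChar (AdeleRing (𝓞 F) F) Circle)
    (hρz : ∀ (t : AdeleRing (𝓞 F) F) (f : S),
      ρ (Heisenberg.ofCenter (heisForm F E V Φ) (Multiplicative.ofAdd t)) f = ((ψ t : Circle) : ℂ) • f)
    (t : AdeleRing (𝓞 F) F) (f : S) :
    (ρ.comp τ) (Heisenberg.ofCenter (heisForm F E V (ξ • Φ)) (Multiplicative.ofAdd t)) f =
      ((ψ.mulShift c t : Circle) : ℂ) • f := by
  rw [comp_apply_apply, hτz, hρz, AddChar.mulShift_apply]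

end Model

/-! ## §5b The rescaled model `ρ ∘ τ_ξ` for the concrete `τ_ξ` -/

section Concrete

variable {F E V Φ}
variable {S : Type} [NormedAddCommGroup S] [InnerProductSpace ℂ S]
variable (ρ : Representation ℂ (AdelicHeisenberg F E V Φ) S)

include hξ in
/-- **central character of the rescaled model**: if `ρ` has central character `ψ`, then `ρ ∘ τ_ξ` has central character
`t ↦ ψ(ξ⁻¹ t)`; in particular, for `ψ = ψ₀(ξ ·)` (Tate: every `ψ` is `ψ_F(ξ ·)`), `ρ ∘ τ_ξ` has central character `ψ₀`.
[cite: GelbartRogawski1991, §3.1 p. 454 L19–21; CasselsFrohlichANT1967, Ch. XV Thm 4.1.4] -/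
theorem comp_heisTwist_ofCenter (ψ ψ₀ : AddChar (AdeleRing (𝓞 F) F) Circle)
    (hψ : ψ = ψ₀.mulShift (algebraMap F (AdeleRing (𝓞 F) F) ξ))
    (hρz : ∀ (t : AdeleRing (𝓞 F) F) (f : S),
      ρ (Heisenberg.ofCenter (heisForm F E V Φ) (Multiplicative.ofAdd t)) f = ((ψ t : Circle) : ℂ) • f)
    (t : AdeleRing (𝓞 F) F) (f : S) :
    (ρ.comp (Heisenberg.map (heisForm F E V Φ) (AddMonoidHom.id _)
        (AddMonoidHom.mulLeft (algebraMap F (AdeleRing (𝓞 F) F) ξ⁻¹)) (heisTwist_compat F E V Φ hξ)))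
      (Heisenberg.ofCenter (heisForm F E V (ξ • Φ)) (Multiplicative.ofAdd t)) f = ((ψ₀ t : Circle) : ℂ) • f := by
  rw [comp_ofCenter _ ρ (algebraMap F (AdeleRing (𝓞 F) F) ξ⁻¹) (heisTwist_ofCenter F E V Φ hξ) ψ hρz, hψ,
    AddChar.mulShift_apply, AddChar.mulShift_apply, ← mul_assoc, ← map_mul, mul_inv_cancel₀ hξ, map_one, one_mul]

/-- **the rescaled model inhabits the printed binders** `_hρu _hρc _hρi _hρz` of `Prop311AsPrinted` for the data `(V, ξΦ)`
and the character `ψ₀` with `ψ = ψ₀(ξ ·)`. [cite: GelbartRogawski1991, §3.1 p. 454 L19–21] -/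
theorem comp_heisTwist_printed_binders (ψ ψ₀ : AddChar (AdeleRing (𝓞 F) F) Circle)
    (hψ : ψ = ψ₀.mulShift (algebraMap F (AdeleRing (𝓞 F) F) ξ))
    (hρu : ∀ (h : AdelicHeisenberg F E V Φ) (f : S), ‖ρ h f‖ = ‖f‖)
    (hρc : ∀ f : S, @Continuous _ _ (heisenbergTopology F E V Φ) _ fun h => ρ h f)
    (hρi : ∀ K : Submodule ℂ S, IsClosed (K : Set S) →
      (∀ (h : AdelicHeisenberg F E V Φ), ∀ f ∈ K, ρ h f ∈ K) → K = ⊥ ∨ K = ⊤)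
    (hρz : ∀ (t : AdeleRing (𝓞 F) F) (f : S),
      ρ (Heisenberg.ofCenter (heisForm F E V Φ) (Multiplicative.ofAdd t)) f = ((ψ t : Circle) : ℂ) • f) :
    (∀ (h : AdelicHeisenberg F E V (ξ • Φ)) (f : S),
        ‖(ρ.comp (Heisenberg.map (heisForm F E V Φ) (AddMonoidHom.id _)
          (AddMonoidHom.mulLeft (algebraMap F (AdeleRing (𝓞 F) F) ξ⁻¹)) (heisTwist_compat F E V Φ hξ))) h f‖ = ‖f‖) ∧
      (∀ f : S, @Continuous _ _ (heisenbergTopology F E V (ξ • Φ)) _ fun h =>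
        (ρ.comp (Heisenberg.map (heisForm F E V Φ) (AddMonoidHom.id _)
          (AddMonoidHom.mulLeft (algebraMap F (AdeleRing (𝓞 F) F) ξ⁻¹)) (heisTwist_compat F E V Φ hξ))) h f) ∧
      (∀ K : Submodule ℂ S, IsClosed (K : Set S) →
        (∀ (h : AdelicHeisenberg F E V (ξ • Φ)), ∀ f ∈ K,
          (ρ.comp (Heisenberg.map (heisForm F E V Φ) (AddMonoidHom.id _)
            (AddMonoidHom.mulLeft (algebraMap F (AdeleRing (𝓞 F) F) ξ⁻¹)) (heisTwist_compat F E V Φ hξ))) h f ∈ K) →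
        K = ⊥ ∨ K = ⊤) ∧
      (∀ (t : AdeleRing (𝓞 F) F) (f : S),
        (ρ.comp (Heisenberg.map (heisForm F E V Φ) (AddMonoidHom.id _)
            (AddMonoidHom.mulLeft (algebraMap F (AdeleRing (𝓞 F) F) ξ⁻¹)) (heisTwist_compat F E V Φ hξ)))
          (Heisenberg.ofCenter (heisForm F E V (ξ • Φ)) (Multiplicative.ofAdd t)) f = ((ψ₀ t : Circle) : ℂ) • f) :=
  ⟨norm_comp_apply _ ρ hρu, continuous_comp_apply _ ρ (continuous_heisTwist F E V Φ hξ) hρc,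
    irreducible_comp _ ρ (heisTwist_surjective F E V Φ hξ) hρi, comp_heisTwist_ofCenter hξ ρ ψ ψ₀ hψ hρz⟩

end Concrete

end Prop311

end Literature.NumberTheory.GelbartRogawski1991

end
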